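import Mathlib.AlgebraicGeometry.Group.Abelian
import Mathlib.AlgebraicGeometry.Morphisms.Finite
import Mathlib.CategoryTheory.Monoidal.Grp
import Mathlib.CategoryTheory.Monoidal.Cartesian.Grp
import Mathlib.CategoryTheory.InducedCategory
import Mathlib.CategoryTheory.Preadditive.Basic
import Mathlib.RingTheory.TensorProduct.Basic
import Mathlib.FieldTheory.IsAlgClosed.AlgebraicClosure
import Summits.Ventures.HodgeRepro2.HostAPI.Carriers.AlgebraicGeometry.Motives.Varieties
import Summits.Ventures.HodgeRepro2.HostAPI.Carriers.AlgebraicGeometry.Motives.AlgPoints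
import Summits.Ventures.HodgeRepro2.HostAPI.Util.ForallBinderLint
open HostAPI.Carriers

universe u

open CategoryTheory AlgebraicGeometry MonoidalCategory
open scoped TensorProduct

noncomputable section

namespace HostAPI.Carriers.AlgebraicGeometry.Motives

structure AbelianVariety (k : Type u) [Field k] where

  X : SchemeOver k

  [grpObj : GrpObj X]

  isProper : IsProper X.hom

  geometricallyIntegral : GeometricallyIntegral X.hom

attribute [instance] AbelianVariety.grpObj AbelianVariety.isProper
  AbelianVariety.geometricallyIntegral

namespace AbelianVariety

variable {k : Type u} [Field k]

@[simps -isSimp X]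
abbrev toGrp (A : AbelianVariety k) : Grp (SchemeOver k) := ⟨A.X⟩

instance instCategory : Category (AbelianVariety k) :=
  inferInstanceAs (Category (InducedCategory _ AbelianVariety.toGrp))

@[simp]
theorem id_hom (A : AbelianVariety k) : (InducedCategory.Hom.hom (𝟙 A)) = 𝟙 A.toGrp :=
  rfl

@[simp]
theorem comp_hom {A B C : AbelianVariety k} (f : A ⟶ B) (g : B ⟶ C) :
    (f ≫ g).hom = f.hom ≫ g.hom :=
  rfl

@[ext]
theorem hom_ext {A B : AbelianVariety k} (f g : A ⟶ B) (h : f.hom.hom.hom = g.hom.hom.hom) :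
    f = g :=
  InducedCategory.hom_ext (Grp.hom_ext _ _ h)

abbrev Hom.toSchemeHom {A B : AbelianVariety k} (f : A ⟶ B) : A.X.left ⟶ B.X.left :=
  f.hom.hom.hom.left

variable (A B C : AbelianVariety k)

instance instIsCommMonObj : IsCommMonObj A.X :=
  isCommMonObj_of_isProper_of_geometricallyIntegral A.X

open scoped MonObj

instance instAddCommGroupHom : AddCommGroup (A ⟶ B) :=
  (InducedCategory.homEquiv.trans Additive.ofMul).addCommGroup

variable {A B C}

theorem hom_add (f g : A ⟶ B) : (f + g).hom = f.hom * g.hom := rfl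

theorem hom_zero : (0 : A ⟶ B).hom = 1 := rfl

instance instPreadditive : Preadditive (AbelianVariety k) where
  add_comp P Q R f f' g := by
    apply InducedCategory.hom_ext
    apply Grp.hom_ext
    change ((f.hom * f'.hom) ≫ g.hom).hom.hom = _
    simp only [hom_add]
    simp [Grp.Hom.hom_mul, MonObj.mul_comp]
  comp_add P Q R f g g' := by
    apply InducedCategory.hom_ext
    apply Grp.hom_ext
    change (f.hom ≫ (g.hom * g'.hom)).hom.hom = _
    simp only [hom_add]
    simp [Grp.Hom.hom_mul, MonObj.comp_mul]

variable (A B C)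

def endAlgebra : Type u := ℚ ⊗[ℤ] End A

instance endAlgebra.instRing : Ring (endAlgebra A) := Algebra.TensorProduct.instRing

instance endAlgebra.instAlgebra : Algebra ℚ (endAlgebra A) := Algebra.TensorProduct.leftAlgebra

def endAlgebra.of : End A →+* endAlgebra A :=
  (Algebra.TensorProduct.includeRight (R := ℤ) (A := ℚ) (B := End A)).toRingHom

def dim : ℕ := schemeDim A.X.left

def isSmoothProjective : Prop :=
  IsSmoothProjective A.dim A.X

variable {A B C}

def IsIsogeny (f : A ⟶ B) : Prop :=
  Surjective (Hom.toSchemeHom f) ∧ IsFinite (Hom.toSchemeHom f)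

def IsIsogenous (A B : AbelianVariety k) : Prop := ∃ f : A ⟶ B, IsIsogeny f

theorem isIsogeny_id (A : AbelianVariety k) : IsIsogeny (𝟙 A) := by
  constructor
  · change Surjective (𝟙 A.X.left)
    infer_instance
  · change IsFinite (𝟙 A.X.left)
    infer_instance

theorem IsIsogenous.refl (A : AbelianVariety k) : IsIsogenous A A := ⟨𝟙 A, isIsogeny_id A⟩

def IsIsogenous.symm : Prop :=
  ∀ (h : IsIsogenous A B),
    IsIsogenous B A

theorem isIsogeny_comp {f : A ⟶ B} {g : B ⟶ C} (hf : IsIsogeny f) (hg : IsIsogeny g) :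
    IsIsogeny (f ≫ g) := by
  obtain ⟨_, _⟩ := hf
  obtain ⟨_, _⟩ := hg
  constructor
  · change Surjective (Hom.toSchemeHom f ≫ Hom.toSchemeHom g)
    infer_instance
  · change IsFinite (Hom.toSchemeHom f ≫ Hom.toSchemeHom g)
    infer_instance

theorem IsIsogenous.trans (hAB : IsIsogenous A B) (hBC : IsIsogenous B C) : IsIsogenous A C := by
  obtain ⟨f, hf⟩ := hAB
  obtain ⟨g, hg⟩ := hBC
  exact ⟨f ≫ g, isIsogeny_comp hf hg⟩

def dim_eq_of_isIsogenous : Prop :=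
  ∀ (h : IsIsogenous A B),
    A.dim = B.dim

def IsSimple (A : AbelianVariety k) : Prop :=
  ∀ (B : AbelianVariety k) (f : B ⟶ A), IsClosedImmersion (Hom.toSchemeHom f) →
    0 < B.dim → B.dim < A.dim → False

theorem isSimple_of_dim_le_one (hA : A.dim ≤ 1) : IsSimple A := by
  intro B _ _ hB hBA
  omega

variable (A)
variable (L : Type u) [Field L] [Algebra k L]

abbrev Points : Type u := AlgPoints A.X L

instance Points.instCommGroup : CommGroup (A.Points L) := inferInstance

def torsionPoints (n : ℤ) : Subgroup (A.Points L) := (zpowGroupHom n).ker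

variable {A L}

theorem mem_torsionPoints_iff (n : ℤ) (P : A.Points L) :
    P ∈ A.torsionPoints L n ↔ P ^ n = 1 :=
  Iff.rfl

def smul_mem_torsionPoints : Prop :=
  ∀ (n : ℤ) (σ : L ≃ₐ[k] L) {P : A.Points L} (hP : P ∈ A.torsionPoints L n),
    σ • P ∈ A.torsionPoints L n

variable (A L) in

def natCard_torsionPoints_of_isAlgClosed : Prop :=
  ∀ [IsAlgClosed L] (n : ℤ) (hn : (n : k) ≠ 0),
    Nat.card (A.torsionPoints L n) = n.natAbs ^ (2 * A.dim)

variable (A L) in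

instance Points.instMulDistribMulAction : MulDistribMulAction (L ≃ₐ[k] L) (A.Points L) where
  smul_mul σ P Q := by
    change AlgPoints.specMap σ ≫ (P * Q) = (AlgPoints.specMap σ ≫ P) * (AlgPoints.specMap σ ≫ Q)
    exact MonObj.comp_mul _ _ _
  smul_one σ := by
    change AlgPoints.specMap σ ≫ (1 : A.Points L) = 1
    exact MonObj.comp_one _

theorem Points.zpow_smul (σ : L ≃ₐ[k] L) (P : A.Points L) (n : ℤ) :
    (σ • P) ^ n = σ • (P ^ n) :=
  (smul_zpow' σ P n).symm

theorem smul_mem_torsionPoints_holds : smul_mem_torsionPoints (A := A) (L := L) := by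
  intro n σ P hP
  rw [mem_torsionPoints_iff] at hP ⊢
  rw [← smul_zpow', hP, smul_one]

theorem smul_mem_torsionPoints_iff (n : ℤ) (σ : L ≃ₐ[k] L) (P : A.Points L) :
    σ • P ∈ A.torsionPoints L n ↔ P ∈ A.torsionPoints L n := by
  refine ⟨fun h => ?_, fun h => smul_mem_torsionPoints_holds n σ h⟩
  have h' := smul_mem_torsionPoints_holds n σ⁻¹ h
  rwa [inv_smul_smul] at h'

end AbelianVariety

end HostAPI.Carriers.AlgebraicGeometry.Motives
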